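/-
Origin: expansion seat `planner-pub-hodgecm-mc-axioms-1-g14-0`, handover #W186 2026-08-20T15:53:55Z md5 25eaea35d5cd (PKG 9cd101a8d93e → 25eaea35d5cd; 127 l.; MECHANICAL (iib-R) rewrite v3.1 of the PKG file as it stands (25 token edits; rules R1x1+RX[h₂']x24)) (`HOME/mc/pub-hodgecm-mc-axioms-1-g14/revendor/kit-r55/stage55/HodgeCM/Model/Sanity/DegenerateClosureR19AE.lean`, md5 25eaea35d5cd, 127 lines);
landed by the gen-22 packager (p-g22) in gate run 55 REPLACES the earlier landed copy of `HodgeCM/Model/Sanity/DegenerateClosureR19AE.lean` (seat copy carried the packager Origin header of an earlier run (stripped)).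
-/
/-
Origin: SANITY lane `planner-pub-hodgecm-mc-sanity-1-g10-0` (unit pub-hodgecm-mc-sanity-1-g10, gen 10 of mc-sanity-1,
node SAN-21), 2026-08-20.  NEW additive KERNEL leaf `HodgeCM/Model/Sanity/DegenerateClosureR19AE.lean` over the
RUN-38 rows `HodgeCM.Model.E2InstanceR19AE` (glue-1 #362: E revision 19AE = R18AE with rows 1 `hHR` / 7 `hBetti`
DISCHARGED by mc-period-1's V-betti twin family, 15 binders) and `HodgeCM.Model.Sanity.DegenerateClosureR18A`
(SAN-20: the degenerate closure of R18A / R18AE; brings SAN-15 `CdegS` / `NoGoodSextic`, SAN-10b, SAN-11, SAN-12,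
SAN-17a, `hsmall_degS`).  Imported by nothing.  INSTALL AFTER both (hence after #362's whole import cone).
KERNEL: 0 records, 0 `Prop` definitions, 0 hypotheses minted, nothing cited, no instances.
Expected `#print axioms`: ⊆ {propext, Classical.choice, Quot.sound}.
-/
import Summits.HodgeConjecture.HodgeCM.Model.E2InstanceR19AE
import Summits.HodgeConjecture.HodgeCM.Model.Sanity.DegenerateClosureR18A

/-!
# SAN-21 — the DEGENERATE CLOSURE of E R19AE (rows 1 `hHR` and 7 `hBetti` discharged in kernel)

MODEL-CONSTRUCTION sub-cell, SANITY lane (unit `pub-hodgecm-mc-sanity-1-g10`, node SAN-21).  KERNEL only; census leaf.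

SAN-20 (`Sanity/DegenerateClosureR18A`) closed E R18A / R18AE over the degenerate inhabitants `S := degS`,
`W := zeroSK ∘ W` modulo the single DATA binder `CdegS` (empty: SAN-15b).  Revision 19AE (RUN 38, glue-1 #362) is
`Model.perL_picardCM_r18AE` with row 1 `hHR := BettiUniverse.HodgeRiemann20_holds` and row 7
`hBetti := embBettiSideOf …` supplied by mc-period-1's V-betti twins (15 binders: `h hA W S μ hR hsmall C hT hpd hk gen12
real34 hyp12 hyp34`).  This file records the degenerate census of that revision:

* `perL_r19AE_degS` — E R19AE at `S := degS`, `W := zeroSK ∘ W` closes `(picardCMUniverse …).PerL` from `h hA W μ hR`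
  and the ONE binder `CdegS`; the eight Prop-row discharges are VERBATIM those of SAN-20 `perL_r18AE_degS` (`hsmall`
  by `hsmall_degS`, `hT` SAN-17a, `hpd` / `hk` by the empty fibre of `C` over `degS` (SAN-10b), `gen12` / `real34` /
  `hyp12` / `hyp34` SAN-12).
* `perL_r19AE_degS'` — the same closure obtained from SAN-20 `perL_r18AE_degS` by feeding it R19AE's two dischargers
  (`BettiUniverse.HodgeRiemann20_holds`, `embBettiSideOf`): the two routes to the census agree by construction.
* `perL_r19AE_of_noGoodSextic` — so R19AE, like R10 / R13 / R15A / R17A / R18A, closes from toys EXACTLY modulo the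
  vacuity residual `NoGoodSextic` (refuted in kernel: SAN-15b `not_noGoodSextic`).

READING (census, MODEL-N ±0; nothing here is a defect claim): discharging `hHR` and `hBetti` removes two HONEST rows
(rows the toys never touched: both are about the Betti side of the universe, not about `S` / `W`); the degenerate
census is unchanged — over degenerate data every binder of E R19AE except `C` is free and `C` is the gatekeeper.  The
binder count seen by the toys drops 17 → 15 with the two removed rows OUTSIDE the degenerate cone.
-/

set_option autoImplicit false

noncomputable section

namespace HodgeCM
namespace Model
namespace Sanity

open HodgeCM.Universe (SideData ThetaModel AdelicThetaCore AdelicTorusCore)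
open HodgeCM.PerL34 HodgeCM.PerL34.ArchC
open Literature.AlgebraicGeometry.HodgeTheory Literature.NumberTheory.Automorphic.PicardCM
open Literature.NumberTheory.Transcendental (Arapura2012_Cor_15_4_6)
open Literature.AlgebraicGeometry.ShimuraVarieties
open HodgeCM.Model.ThetaSpace
open HodgeCM.Model.SupplyResidual

variable (hHD : exists_isReal_hodgeModel) (hI : hodgePQ_independent_of_hodgeModel)
  (h₁ : BallQuotientUniformised)

/-- **E R19AE over the degenerate data closes PerL modulo the single binder `C`** — every Prop-row discharge
VERBATIM as in SAN-20 `perL_r18AE_degS`; rows 1 / 7 are no longer binders. -/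
theorem perL_r19AE_degS (h₃' : CMAbelianVarietyEigenbasisRealised) (h : Bool)
    (hA : Arapura2012_Cor_15_4_6)
    (W : ∀ {L : CMField} {ι₁ : L →+* ℂ} (V : HermSpace3 L ι₁) (c : SeesawCtx L), WmInput V c.D)
    (μ : ∀ {L : CMField}, SeesawCtx L → Fin 4 → NumberField.InfinitePlace L → ℤ)
    (hR : DeligneMilne1982_Thm_6_20_full)
    (C : CdegS hHD hI h₁ (cmAbelianVarietyRealised_of_eigenbasis hHD hI h₃') h hA W μ) :
    (picardCMUniverse hHD hI h₁ (cmAbelianVarietyRealised_of_eigenbasis hHD hI h₃')).PerL := by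
  refine perL_picardCM_r19AE hHD hI h₁ h₃' h hA (fun V c => (W V c).zeroSK) degS μ hR
    ?_ C ?_ ?_ ?_ ?_ ?_ ?_ ?_
  · -- `hsmall`
    intro L ι₁ V c hc hK i
    exact hsmall_degS hHD hI h₁ _ h (embOf hHD hI h₁ _) (coverOf hHD hI h₁ _ hA)
      (wmOfInput fun V c => (W V c).zeroSK) (d12Of μ) (d34Of μ) V c hc hK i
  · -- `hT`
    intro L ι₁ V c k N
    exact isThetaArchContinuous_degS V c k N
  · -- `hpd`
    intro L ι₁ V c hV hc h6 k hk N hN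
    exact ((isEmpty_C_fibre_degS hHD hI h₁ _ V c hV).false (C V c hV hc h6)).elim
  · -- `hk`
    intro L ι₁ V c hV hc h6 k hk N hN
    exact ((isEmpty_C_fibre_degS hHD hI h₁ _ V c hV).false (C V c hV hc h6)).elim
  · -- `gen12`
    intro L ι₁ V c
    exact gen12_degS' hHD hI h₁ _ h (embOf hHD hI h₁ _) (coverOf hHD hI h₁ _ hA)
      (fun V c => (W V c).zeroSK) μ V c
  · -- `real34`
    intro L ι₁ V c _ _
    exact real34_zeroSK (embOf hHD hI h₁ _) (coverOf hHD hI h₁ _ hA) W _ h (d12Of μ) (d34Of μ) V c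
  · -- `hyp12`
    intro L ι₁ V c _ _
    exact hyp12_zeroSK (embOf hHD hI h₁ _) (coverOf hHD hI h₁ _ hA) W _ h _ _ _ V c
  · -- `hyp34`
    intro L ι₁ V c _ _
    exact hyp34_zeroSK (embOf hHD hI h₁ _) (coverOf hHD hI h₁ _ hA) W _ h _ _ _ V c

/-- The same closure through SAN-20: `perL_r18AE_degS` fed with R19AE's two in-kernel dischargers of rows 1 / 7. -/
theorem perL_r19AE_degS' (h₃' : CMAbelianVarietyEigenbasisRealised) (h : Bool)
    (hA : Arapura2012_Cor_15_4_6)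
    (W : ∀ {L : CMField} {ι₁ : L →+* ℂ} (V : HermSpace3 L ι₁) (c : SeesawCtx L), WmInput V c.D)
    (μ : ∀ {L : CMField}, SeesawCtx L → Fin 4 → NumberField.InfinitePlace L → ℤ)
    (hR : DeligneMilne1982_Thm_6_20_full)
    (C : CdegS hHD hI h₁ (cmAbelianVarietyRealised_of_eigenbasis hHD hI h₃') h hA W μ) :
    (picardCMUniverse hHD hI h₁ (cmAbelianVarietyRealised_of_eigenbasis hHD hI h₃')).PerL :=
  perL_r18AE_degS hHD hI h₁ h₃' BettiUniverse.HodgeRiemann20_holds h hA W μ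
    (embBettiSideOf hHD hI h₁ (cmAbelianVarietyRealised_of_eigenbasis hHD hI h₃')) hR C

/-- **E R19AE closes from the degenerate data EXACTLY modulo the vacuity residual `NoGoodSextic`** (cf. SAN-20
`perL_r18A_of_noGoodSextic`; the residual is refuted by SAN-15b `not_noGoodSextic`). -/
theorem perL_r19AE_of_noGoodSextic (h₃' : CMAbelianVarietyEigenbasisRealised) (h : Bool)
    (hA : Arapura2012_Cor_15_4_6)
    (W : ∀ {L : CMField} {ι₁ : L →+* ℂ} (V : HermSpace3 L ι₁) (c : SeesawCtx L), WmInput V c.D)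
    (μ : ∀ {L : CMField}, SeesawCtx L → Fin 4 → NumberField.InfinitePlace L → ℤ)
    (hR : DeligneMilne1982_Thm_6_20_full)
    (hno : NoGoodSextic hHD hI h₁ (cmAbelianVarietyRealised_of_eigenbasis hHD hI h₃') h hA W μ) :
    (picardCMUniverse hHD hI h₁ (cmAbelianVarietyRealised_of_eigenbasis hHD hI h₃')).PerL :=
  perL_r19AE_degS hHD hI h₁ h₃' h hA W μ hR fun V c hV hc h6 => (hno V c hV hc h6).elim

end Sanity
end Model
end HodgeCM

end
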